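import Literature.NumberTheory.DiophantineGeometry.FunctionFieldResidues
import HarnessLib

/-!
# The derivation `d/dt` of an algebraic function field attached to a non-constant `t`

Topic: `Literature/NumberTheory/DiophantineGeometry`. Continuation of
`Literature.NumberTheory.DiophantineGeometry.FunctionFieldResidues` (Tate's residues, the Weil
differential `dy = dOf K y` of an element, its divisor `(dy)_P = diffOrd_P(y)`).

For an algebraic function field `F/K` with full constant field `K` we record the calculus of the
exact differentials `dy` (`dOf_add`, `dOf_mul` — the Leibniz rule, `dOf_algebraMap`) and define, for
`t ∈ F` with `dt ≠ 0`, the **derivative with respect to `t`**, `tderiv K t y = dy/dt ∈ F`: the unique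
`x ∈ F` with `dy = x · dt` (the space of Weil differentials is one-dimensional over `F`, Stichtenoth
Prop. 1.5.9, `exists_smul_eq_of_ne_zero`; this is Stichtenoth's Def. 4.1.7 of the derivation
`δ_t : F → F` "with respect to a separating element `t`", read through Thm. 4.3.2 (e) `dy = (dy/dt) dt`).
It is a `K`-derivation of `F` (`tderivation`), `dt/dt = 1`, it satisfies the chain rule
`dy/dz = dy/dt · dt/dz` (Stichtenoth Prop. 4.1.8 (c)), its kernel is `K` in characteristic `0`, and —
the point of this file — its values have controlled orders at every place (all places rational,
characteristic `0`): `v_P(dy/dt) = diffOrd_P(y) - diffOrd_P(t)` (`ord_tderiv`, from `(x ω) = (x) + (ω)`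
and `(dy)_P = diffOrd_P(y)`), so that for a local parameter `t = t_P` at `P` the derivation `d/dt_P`
maps `𝒪_P` into itself and lowers the order of any function by at most one
(`tderiv_uniformizer_mem`, `ord_sub_one_le_ord_tderiv_uniformizer`; Stichtenoth Prop. 4.3.? /
Mason 1984, Ch. I §2, (6): "`v(df/dv) ≥ v(f) - 1`, with `v(df/dv) ≥ 0` if `v(f) ≥ 0`"). These are the
standard facts about derivatives used in Wronskian arguments over function fields
(Corvaja–Zannier 2008, §2; Mason 1984, Ch. I).

Everything is proved; no named facts are introduced.

## References

* H. Stichtenoth, *Algebraic Function Fields and Codes*, 2nd ed., GTM 254 (2009): Prop. 1.5.9,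
  Prop. 1.5.13, Def. 4.1.7, Prop. 4.1.8, Thm. 4.3.2. [Stichtenoth2009]
* R. C. Mason, *Diophantine Equations over Function Fields*, LMS LNS 96 (1984), Ch. I §2. [Mason1984]
* P. Corvaja, U. Zannier, *Some cases of Vojta's conjecture on integral points over function fields*,
  J. Algebraic Geom. 17 (2008), §2. [CorvajaZannier2007]
-/

noncomputable section

open scoped Classical IntermediateField

namespace Literature.NumberTheory.DiophantineGeometry.AlgFunctionField

universe u v

variable {K : Type u} {F : Type v} [Field K] [Field F] [Algebra K F]

/-! ### Calculus of the exact differentials `dy` -/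

section dOfCalculus

variable [IsAlgFunctionField K F] [IsIntegrallyClosedIn K F]

/-- `d(y + z) = dy + dz` (bilinearity of the local residues). [cite: Stichtenoth2009, Prop. 4.1.8] -/
theorem dOf_add (y z : F) : dOf K (y + z) = dOf K y + dOf K z := by
  apply Subtype.ext; apply LinearMap.ext; intro α
  change weilFun (y + z) α = weilFun y α + weilFun z α
  set S := badFinset α y ∪ badFinset α z with hS
  have hy : ∀ P ∉ S, α P ∈ P.toValuationSubring ∧ y ∈ P.toValuationSubring := fun P hP ↦
    mem_of_not_mem_badFinset fun h ↦ hP (Finset.mem_union_left _ h)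
  have hz : ∀ P ∉ S, α P ∈ P.toValuationSubring ∧ z ∈ P.toValuationSubring := fun P hP ↦
    mem_of_not_mem_badFinset fun h ↦ hP (Finset.mem_union_right _ h)
  rw [weilFun_eq_sum _ α S (fun P hP ↦ ⟨(hy P hP).1, add_mem (hy P hP).2 (hz P hP).2⟩),
    weilFun_eq_sum _ α S hy, weilFun_eq_sum _ α S hz, ← Finset.sum_add_distrib]
  exact Finset.sum_congr rfl fun P _ ↦ PlaceOver.localRes_add_right P _ _ _

/-- **Leibniz rule** `d(yz) = y dz + z dy` (from the Leibniz rule for local residues).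
[cite: Stichtenoth2009, Prop. 4.1.8] -/
theorem dOf_mul (y z : F) : dOf K (y * z) = y • dOf K z + z • dOf K y := by
  apply Subtype.ext; apply LinearMap.ext; intro α
  rw [Submodule.coe_add, LinearMap.add_apply, weilDifferential.smul_apply,
    weilDifferential.smul_apply]
  change weilFun (y * z) α = weilFun z (y • α) + weilFun y (z • α)
  set S := badFinset α y ∪ badFinset α z with hS
  have hy : ∀ P ∉ S, α P ∈ P.toValuationSubring ∧ y ∈ P.toValuationSubring := fun P hP ↦
    mem_of_not_mem_badFinset fun h ↦ hP (Finset.mem_union_left _ h)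
  have hz : ∀ P ∉ S, α P ∈ P.toValuationSubring ∧ z ∈ P.toValuationSubring := fun P hP ↦
    mem_of_not_mem_badFinset fun h ↦ hP (Finset.mem_union_right _ h)
  rw [weilFun_eq_sum _ α S (fun P hP ↦ ⟨(hy P hP).1, mul_mem (hy P hP).2 (hz P hP).2⟩),
    weilFun_eq_sum _ _ S (fun P hP ↦ ⟨by rw [Adele.smul_apply]; exact mul_mem (hy P hP).2 (hy P hP).1,
      (hz P hP).2⟩),
    weilFun_eq_sum _ _ S (fun P hP ↦ ⟨by rw [Adele.smul_apply]; exact mul_mem (hz P hP).2 (hy P hP).1,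
      (hy P hP).2⟩), ← Finset.sum_add_distrib]
  refine Finset.sum_congr rfl fun P _ ↦ ?_
  rw [Adele.smul_apply, Adele.smul_apply, PlaceOver.localRes_mul_right, mul_comm y, mul_comm z]

/-- `dc = 0` for a constant `c ∈ K`. [cite: Stichtenoth2009, Prop. 4.1.8] -/
theorem dOf_algebraMap (c : K) : dOf K (algebraMap K F c) = 0 := by
  apply Subtype.ext; apply LinearMap.ext; intro α
  change weilFun (algebraMap K F c) α = 0
  rw [weilFun_eq_sum _ α (badFinset α (algebraMap K F c)) fun P hP ↦ mem_of_not_mem_badFinset hP]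
  exact Finset.sum_eq_zero fun P _ ↦ PlaceOver.localRes_algebraMap_right P _ _

/-- `d1 = 0`. [cite: Stichtenoth2009, Prop. 4.1.8] -/
theorem dOf_one : dOf K (1 : F) = 0 := by
  simpa using dOf_algebraMap (K := K) (F := F) 1

/-- `d(c y) = c dy` for a constant `c ∈ K`. [cite: Stichtenoth2009, Prop. 4.1.8] -/
theorem dOf_smul (c : K) (y : F) : dOf K (c • y) = c • dOf K y := by
  rw [Algebra.smul_def, dOf_mul, dOf_algebraMap, smul_zero, add_zero, algebraMap_smul]

/-- `d(-y) = -dy`. [cite: Stichtenoth2009, Prop. 4.1.8] -/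
theorem dOf_neg (y : F) : dOf K (-y) = -dOf K y := by
  have h : dOf K (-y) + dOf K y = 0 := by
    rw [← dOf_add, neg_add_cancel]
    simpa using dOf_algebraMap (K := K) (F := F) 0
  have h' := congrArg Subtype.val h
  rw [Submodule.coe_add, Submodule.coe_zero] at h'
  apply Subtype.ext
  rw [Submodule.coe_neg]
  exact eq_neg_of_add_eq_zero_left h'

/-- `d(y - z) = dy - dz`. [cite: Stichtenoth2009, Prop. 4.1.8] -/
theorem dOf_sub (y z : F) : dOf K (y - z) = dOf K y - dOf K z := by
  have h : dOf K (y - z) + dOf K z = dOf K y := by rw [← dOf_add, sub_add_cancel]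
  have h' := congrArg Subtype.val h
  rw [Submodule.coe_add] at h'
  apply Subtype.ext
  rw [Submodule.coe_sub]
  exact eq_sub_of_add_eq h'

end dOfCalculus

/-! ### The derivative `dy/dt` -/

section tderiv

variable [IsAlgFunctionField K F] [IsIntegrallyClosedIn K F]

variable (K) in
/-- **The derivative `dy/dt` of `y` with respect to `t`**: the unique `x ∈ F` with `dy = x · dt`
(Weil differentials form a one-dimensional `F`-space, Stichtenoth Prop. 1.5.9; this is the derivation
`δ_t` of Def. 4.1.7 by Thm. 4.3.2 (e)). Junk value `0` when `dt = 0` (e.g. `t ∈ K`).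
[cite: Stichtenoth2009, Def. 4.1.7, Thm. 4.3.2] -/
def tderiv (t y : F) : F :=
  if ht : dOf K t ≠ 0 then (exists_smul_eq_of_ne_zero ht (dOf K y)).choose else 0

/-- The defining property `dy = (dy/dt) · dt`. [cite: Stichtenoth2009, Thm. 4.3.2] -/
theorem dOf_eq_tderiv_smul {t : F} (ht : dOf K t ≠ 0) (y : F) :
    dOf K y = tderiv K t y • dOf K t := by
  rw [tderiv, dif_pos ht]
  exact (exists_smul_eq_of_ne_zero ht (dOf K y)).choose_spec

/-- Uniqueness: `dy = x · dt` forces `x = dy/dt`. [cite: Stichtenoth2009, Prop. 1.5.9] -/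
theorem tderiv_eq_of_dOf_eq {t : F} (ht : dOf K t ≠ 0) {y x : F} (h : dOf K y = x • dOf K t) :
    tderiv K t y = x :=
  smul_left_injective_of_ne_zero ht ((dOf_eq_tderiv_smul ht y).symm.trans h)

/-- The junk case: `dy/dt = 0` for every `y` when `dt = 0`. [folklore] -/
theorem tderiv_of_dOf_eq_zero {t : F} (ht : dOf K t = 0) (y : F) : tderiv K t y = 0 := by
  rw [tderiv, dif_neg (not_not.2 ht)]

/-- `d(y + z)/dt = dy/dt + dz/dt`. [cite: Stichtenoth2009, Def. 4.1.7] -/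
theorem tderiv_add (t y z : F) : tderiv K t (y + z) = tderiv K t y + tderiv K t z := by
  by_cases ht : dOf K t ≠ 0
  · exact tderiv_eq_of_dOf_eq ht (by rw [dOf_add, add_smul, ← dOf_eq_tderiv_smul ht,
      ← dOf_eq_tderiv_smul ht])
  · simp [tderiv_of_dOf_eq_zero (not_not.1 ht)]

/-- `d(c y)/dt = c dy/dt` for `c ∈ K`. [cite: Stichtenoth2009, Def. 4.1.7] -/
theorem tderiv_smul (t : F) (c : K) (y : F) : tderiv K t (c • y) = c • tderiv K t y := by
  by_cases ht : dOf K t ≠ 0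
  · exact tderiv_eq_of_dOf_eq ht (by rw [dOf_smul, smul_assoc, ← dOf_eq_tderiv_smul ht])
  · simp [tderiv_of_dOf_eq_zero (not_not.1 ht)]

/-- **Leibniz rule** `d(yz)/dt = y dz/dt + z dy/dt`. [cite: Stichtenoth2009, Def. 4.1.7] -/
theorem tderiv_mul (t y z : F) : tderiv K t (y * z) = y * tderiv K t z + z * tderiv K t y := by
  by_cases ht : dOf K t ≠ 0
  · exact tderiv_eq_of_dOf_eq ht (by rw [dOf_mul, add_smul, mul_smul, mul_smul,
      ← dOf_eq_tderiv_smul ht, ← dOf_eq_tderiv_smul ht])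
  · simp [tderiv_of_dOf_eq_zero (not_not.1 ht)]

/-- `dc/dt = 0` for a constant `c ∈ K`. [cite: Stichtenoth2009, Prop. 4.1.8] -/
theorem tderiv_algebraMap (t : F) (c : K) : tderiv K t (algebraMap K F c) = 0 := by
  by_cases ht : dOf K t ≠ 0
  · exact tderiv_eq_of_dOf_eq ht (by rw [dOf_algebraMap, zero_smul])
  · exact tderiv_of_dOf_eq_zero (not_not.1 ht) _

/-- `d0/dt = 0`. [folklore] -/
@[simp]
theorem tderiv_zero (t : F) : tderiv K t 0 = 0 := by
  simpa using tderiv_algebraMap (K := K) t 0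

/-- `d1/dt = 0`. [folklore] -/
@[simp]
theorem tderiv_one (t : F) : tderiv K t 1 = 0 := by
  simpa using tderiv_algebraMap (K := K) t 1

/-- `d(-y)/dt = -dy/dt`. [folklore] -/
theorem tderiv_neg (t y : F) : tderiv K t (-y) = -tderiv K t y := by
  simpa using tderiv_smul (K := K) t (-1 : K) y

/-- `d(y - z)/dt = dy/dt - dz/dt`. [folklore] -/
theorem tderiv_sub (t y z : F) : tderiv K t (y - z) = tderiv K t y - tderiv K t z := by
  rw [sub_eq_add_neg, tderiv_add, tderiv_neg, sub_eq_add_neg]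

/-- `d(c y)/dt = c dy/dt` for `c ∈ K`, multiplicative form. [folklore] -/
theorem tderiv_algebraMap_mul (t : F) (c : K) (y : F) :
    tderiv K t (algebraMap K F c * y) = algebraMap K F c * tderiv K t y := by
  rw [← Algebra.smul_def, tderiv_smul, Algebra.smul_def]

/-- `dt/dt = 1` (when `dt ≠ 0`). [cite: Stichtenoth2009, Def. 4.1.7] -/
theorem tderiv_self {t : F} (ht : dOf K t ≠ 0) : tderiv K t t = 1 :=
  tderiv_eq_of_dOf_eq ht (one_smul F _).symm

/-- `d(yⁿ)/dt = n yⁿ⁻¹ dy/dt`. [folklore] -/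
theorem tderiv_pow (t y : F) (n : ℕ) :
    tderiv K t (y ^ n) = n * y ^ (n - 1) * tderiv K t y := by
  induction n with
  | zero => simp
  | succ n ih =>
    rw [pow_succ, tderiv_mul, ih]
    rcases n with _ | n
    · simp
    · push_cast
      simp only [pow_succ]
      ring

/-- **Chain rule** `dy/dz = (dy/dt) · (dt/dz)`. [cite: Stichtenoth2009, Prop. 4.1.8] -/
theorem tderiv_eq_tderiv_mul_tderiv {z t : F} (hz : dOf K z ≠ 0) (ht : dOf K t ≠ 0) (y : F) :
    tderiv K z y = tderiv K t y * tderiv K z t :=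
  tderiv_eq_of_dOf_eq hz (by rw [mul_smul, ← dOf_eq_tderiv_smul hz, ← dOf_eq_tderiv_smul ht])

variable (K) in
/-- `d/dt` as a `K`-derivation of `F`. [cite: Stichtenoth2009, Def. 4.1.7] -/
def tderivation (t : F) : Derivation K F F where
  toFun := tderiv K t
  map_add' := tderiv_add t
  map_smul' := tderiv_smul t
  map_one_eq_zero' := tderiv_one t
  leibniz' y z := by
    change tderiv K t (y * z) = y • tderiv K t z + z • tderiv K t y
    rw [tderiv_mul, smul_eq_mul, smul_eq_mul]

/-- Unfolding of `tderivation`. [folklore] -/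
@[simp]
theorem tderivation_apply (t y : F) : tderivation K t y = tderiv K t y := rfl

variable (K) in
/-- `d/dt` as a `K`-linear endomorphism of `F` (for iterates and Wronskians). [folklore] -/
def tderivLin (t : F) : F →ₗ[K] F := (tderivation K t).toLinearMap

/-- Unfolding of `tderivLin`. [folklore] -/
@[simp]
theorem tderivLin_apply (t y : F) : tderivLin K t y = tderiv K t y := rfl

/-- Iterates: `(d/dt)ⁿ` as a power of the endomorphism is the `n`-fold iterate. [folklore] -/
theorem tderivLin_pow_apply (t : F) (n : ℕ) (y : F) :
    (tderivLin K t ^ n) y = (tderiv K t)^[n] y := by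
  rw [Module.End.pow_apply]
  rfl

end tderiv

/-! ### The kernel of `d/dt` and the orders of derivatives (characteristic `0`, rational places) -/

section orders

variable [IsAlgFunctionField K F] [IsIntegrallyClosedIn K F] [CharZero K]

/-- In characteristic `0` with all places rational, `dy/dt = 0 ↔ y ∈ K` (for `t ∉ K`): the kernel of
the derivation is the constant field. [cite: Stichtenoth2009, Prop. 4.1.8] -/
theorem tderiv_eq_zero_iff (hrat : ∀ P : PlaceOver K F, P.IsRational) {t : F}
    (ht : t ∉ Set.range (algebraMap K F)) (y : F) :
    tderiv K t y = 0 ↔ y ∈ Set.range (algebraMap K F) := by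
  have hdt := dOf_ne_zero hrat ht
  constructor
  · intro h
    by_contra hy
    exact dOf_ne_zero hrat hy (by rw [dOf_eq_tderiv_smul hdt y, h, zero_smul])
  · rintro ⟨c, rfl⟩
    exact tderiv_algebraMap t c

/-- `dy/dt ≠ 0` for `y, t ∉ K`. [cite: Stichtenoth2009, Prop. 4.1.8] -/
theorem tderiv_ne_zero (hrat : ∀ P : PlaceOver K F, P.IsRational) {t y : F}
    (ht : t ∉ Set.range (algebraMap K F)) (hy : y ∉ Set.range (algebraMap K F)) :
    tderiv K t y ≠ 0 := fun h ↦ hy ((tderiv_eq_zero_iff hrat ht y).1 h)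

/-- **The order of a derivative**: `v_P(dy/dt) = diffOrd_P(y) - diffOrd_P(t)` for `y, t ∉ K`
(`(dy) = (dy/dt) + (dt)` by Stichtenoth Prop. 1.5.13 (a), and `(dy)_P = diffOrd_P(y)`).
[cite: Stichtenoth2009, Prop. 1.5.13, Thm. 4.3.2] -/
theorem ord_tderiv (hrat : ∀ P : PlaceOver K F, P.IsRational) {t y : F}
    (ht : t ∉ Set.range (algebraMap K F)) (hy : y ∉ Set.range (algebraMap K F)) (P : PlaceOver K F) :
    P.ord (tderiv K t y) = P.diffOrd y - P.diffOrd t := by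
  have hdt := dOf_ne_zero hrat ht
  have hx0 := tderiv_ne_zero hrat ht hy
  have h := differentialDivisor_smul hx0 hdt
  rw [← dOf_eq_tderiv_smul hdt y] at h
  have hP := congrArg (fun D : Divisor K F ↦ D P) h
  simp only [Finsupp.coe_add, Pi.add_apply, differentialDivisor_dOf_apply hrat hy,
    differentialDivisor_dOf_apply hrat ht, principalDivisor_apply_of_ne_zero hx0] at hP
  linarith

omit [IsAlgFunctionField K F] [IsIntegrallyClosedIn K F] [CharZero K] in
/-- A uniformizer is not a constant. [folklore] -/
theorem PlaceOver.uniformizer_not_mem_range (P : PlaceOver K F) :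
    (P.uniformizer : F) ∉ Set.range (algebraMap K F) := by
  rintro ⟨c, hc⟩
  have h1 := P.ord_uniformizer_eq_one
  rw [← hc] at h1
  rcases eq_or_ne c 0 with rfl | hc0
  · rw [map_zero, PlaceOver.ord_zero] at h1
    exact zero_ne_one h1
  · rw [PlaceOver.ord_algebraMap_holds P hc0] at h1
    exact zero_ne_one h1

omit [IsIntegrallyClosedIn K F] [CharZero K] in
/-- `diffOrd_P(t_P) = 0` for the uniformizer `t_P` of `P` (`t_P ≡ 0`, `v_P(t_P) = 1`).
[cite: Stichtenoth2009, Thm. 3.5.1] -/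
theorem PlaceOver.diffOrd_uniformizer (P : PlaceOver K F) : P.diffOrd (P.uniformizer : F) = 0 := by
  have hmem : (P.uniformizer : F) - algebraMap K F 0 ∈ P.ball 1 := by
    rw [map_zero, sub_zero]
    exact (P.mem_ball_iff_le_ord 1 P.coe_uniformizer_ne_zero).2 P.ord_uniformizer_eq_one.ge
  rw [P.diffOrd_of_sub_algebraMap_mem hmem, map_zero, sub_zero, P.ord_uniformizer_eq_one]
  rfl

omit [IsIntegrallyClosedIn K F] [CharZero K] in
/-- `diffOrd_P(y) ≥ v_P(y) - 1` for `y ∉ K` at a rational place. [cite: Stichtenoth2009, Thm. 3.5.1, Remark 4.3.7] -/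
theorem PlaceOver.IsRational.ord_sub_one_le_diffOrd {P : PlaceOver K F} (hP : P.IsRational) {y : F}
    (hy : y ∉ Set.range (algebraMap K F)) : P.ord y - 1 ≤ P.diffOrd y := by
  have hy0 : y ≠ 0 := fun h ↦ hy ⟨0, by rw [h, map_zero]⟩
  by_cases hyO : y ∈ P.toValuationSubring
  · rcases (P.ord_nonneg_of_mem hyO).eq_or_lt with h0 | hpos
    · have := hP.diffOrd_nonneg hy hyO
      omega
    · have hmem : y - algebraMap K F 0 ∈ P.ball 1 := by
        rw [map_zero, sub_zero]
        exact (P.mem_ball_iff_le_ord 1 hy0).2 (by omega)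
      rw [P.diffOrd_of_sub_algebraMap_mem hmem, map_zero, sub_zero]
  · rw [P.diffOrd_of_not_mem hyO]

/-- **`v_P(dy/dt_P) = diffOrd_P(y)`** for the local parameter `t_P` at `P` and `y ∉ K`.
[cite: Stichtenoth2009, Thm. 3.5.1, Thm. 4.3.2] -/
theorem ord_tderiv_uniformizer (hrat : ∀ P : PlaceOver K F, P.IsRational) (P : PlaceOver K F) {y : F}
    (hy : y ∉ Set.range (algebraMap K F)) :
    P.ord (tderiv K (P.uniformizer : F) y) = P.diffOrd y := by
  rw [ord_tderiv hrat P.uniformizer_not_mem_range hy, P.diffOrd_uniformizer, sub_zero]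

/-- **Differentiation with respect to a local parameter lowers orders by at most one**:
`v_P(dy/dt_P) ≥ v_P(y) - 1` for every `y` (Mason 1984, Ch. I §2 (6): "`v(df/dv) ≥ v(f) - 1`"; for
`y ∈ K` both sides are computed with the junk value `v_P(0) = 0`). [cite: Mason1984, Ch. I §2 (6)] -/
theorem ord_sub_one_le_ord_tderiv_uniformizer (hrat : ∀ P : PlaceOver K F, P.IsRational)
    (P : PlaceOver K F) (y : F) :
    P.ord y - 1 ≤ P.ord (tderiv K (P.uniformizer : F) y) := by
  by_cases hy : y ∈ Set.range (algebraMap K F)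
  · obtain ⟨c, rfl⟩ := hy
    rw [tderiv_algebraMap, PlaceOver.ord_zero]
    rcases eq_or_ne c 0 with rfl | hc0
    · rw [map_zero, PlaceOver.ord_zero]; norm_num
    · rw [PlaceOver.ord_algebraMap_holds P hc0]; norm_num
  · rw [ord_tderiv_uniformizer hrat P hy]
    exact (hrat P).ord_sub_one_le_diffOrd hy

/-- Iterated form: `v_P(dⁿy/dt_Pⁿ) ≥ v_P(y) - n`. [cite: Mason1984, Ch. I §2 (6)] -/
theorem ord_sub_le_ord_iterate_tderiv_uniformizer (hrat : ∀ P : PlaceOver K F, P.IsRational)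
    (P : PlaceOver K F) (y : F) (n : ℕ) :
    P.ord y - n ≤ P.ord ((tderiv K (P.uniformizer : F))^[n] y) := by
  induction n with
  | zero => simp
  | succ n ih =>
    rw [Function.iterate_succ_apply']
    have := ord_sub_one_le_ord_tderiv_uniformizer hrat P ((tderiv K (P.uniformizer : F))^[n] y)
    push_cast
    omega

/-- **Differentiation with respect to a local parameter preserves integrality**: `y ∈ 𝒪_P ⇒
dy/dt_P ∈ 𝒪_P` (Mason 1984, Ch. I §2 (6): "`v(df/dv) ≥ 0` if `v(f) ≥ 0`"; `diffOrd_P(y) ≥ 0` at a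
finite place). [cite: Mason1984, Ch. I §2 (6)] -/
theorem tderiv_uniformizer_mem (hrat : ∀ P : PlaceOver K F, P.IsRational) (P : PlaceOver K F) {y : F}
    (hy : y ∈ P.toValuationSubring) : tderiv K (P.uniformizer : F) y ∈ P.toValuationSubring := by
  by_cases hyK : y ∈ Set.range (algebraMap K F)
  · obtain ⟨c, rfl⟩ := hyK
    rw [tderiv_algebraMap]
    exact zero_mem _
  · have h0 := ord_tderiv_uniformizer hrat P hyK
    have hne := tderiv_ne_zero hrat P.uniformizer_not_mem_range hyK
    exact (P.mem_toValuationSubring_iff_ord_nonneg hne).2 (by rw [h0]; exact (hrat P).diffOrd_nonneg hyK hy)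

/-- Iterated form: `y ∈ 𝒪_P ⇒ dⁿy/dt_Pⁿ ∈ 𝒪_P`. [cite: Mason1984, Ch. I §2 (6)] -/
theorem iterate_tderiv_uniformizer_mem (hrat : ∀ P : PlaceOver K F, P.IsRational) (P : PlaceOver K F)
    {y : F} (hy : y ∈ P.toValuationSubring) (n : ℕ) :
    (tderiv K (P.uniformizer : F))^[n] y ∈ P.toValuationSubring := by
  induction n with
  | zero => simpa using hy
  | succ n ih =>
    rw [Function.iterate_succ_apply']
    exact tderiv_uniformizer_mem hrat P ih

/-- The order of `dt/dt_P` for a global `t ∉ K`: `v_P(dt/dt_P) = diffOrd_P(t)`; summed over all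
places this is `2g - 2` (`finsum_diffOrd_eq`). [cite: Stichtenoth2009, Cor. 3.4.14, Thm. 3.5.1] -/
theorem finsum_ord_tderiv_uniformizer (hrat : ∀ P : PlaceOver K F, P.IsRational) {t : F}
    (ht : t ∉ Set.range (algebraMap K F)) :
    ∑ᶠ P : PlaceOver K F, P.ord (tderiv K (P.uniformizer : F) t) = 2 * genus K F - 2 := by
  rw [← finsum_diffOrd_eq hrat ht]
  exact finsum_congr fun P ↦ ord_tderiv_uniformizer hrat P ht

end orders

end Literature.NumberTheory.DiophantineGeometry.AlgFunctionField
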